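import Literature.MathematicalPhysics.QuantumFieldTheory.Balaban1983to89.B8Thm8FlatAbelianFamily

/-!
# Bałaban CMP 99 (1985) 75–102 [B8], Theorem 8 (p. 101) AS PRINTED fails for `U(1)`-VALUED gauge transformations on the
# tori of record: the lifting lemma (pure gauge with small potential + (1.29) ⇒ exponential chart) and
# `¬ B8SectGH.Thm8PrintedAt 1 B₁ B₂ fam` for the `U(1)`-valued flat abelian family

statement-level skeleton of published theorems with citation tags; proofs where landed; nothing here is a claim about the Yang–Mills mass gap

Bałaban, T.: "Spaces of regular gauge field configurations on a lattice and gauge fixing conditions", Commun. Math.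
Phys. 99 (1985) 75–102 [cite: Balaban1985RegularSpaces] (B8; PDF page = journal page − 74); [3] = Bałaban, T.:
"Averaging operations for lattice gauge theories", Commun. Math. Phys. 98 (1985) 17–51 [cite: Balaban1985Averaging]
(PDF page = journal page − 16); [4] = "Propagators for lattice gauge theories in a background field", ibid. 99 (1985)
389–434 [cite: Balaban1985BackgroundPropagators].

WHAT IS PRINTED.  Theorem 8 (p. 101) — quoted in full in `B8Thm8FlatAbelianFamily` — asserts, for sources `f ∈ R(U₀)`
with `|f|₍₋₂₎ < γ(α₀ + α₁)`, a gauge transformation `u` restricted by (1.29) "(R₀ū^j)(y) = 1 for y ∈ Λ_j" with (1.36),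
(1.37), (1.39), (1.146) for `U₁ = U′^{u⁻¹}`, constants "B₁, B₂(β₀) as in Theorems 2, 4" ("absolute constants depending
on d and L only", p. 83).  The averages in (1.29) are those of [3] (78)–(81) (p. 30): the one-step operation (78)
"(R₀v)(y) = (R(V₀)v)(y) = v(y) exp[i Σ_{x∈B(y)} L^{−d} (1/i) log(v(y)⁻¹ R(V₀(Γ_{y,x})) v(x))]" iterated through the
lattices ((79)–(80)), and the restriction (81) "(R₀ū^k)(y) = 1, y ∈ Ω^{(k)}"; p. 80: "for u(x) = e^{iλ(x)} and λ small a
linear part of the function (1/i) log(R₀u^j)(y) is equal to (Q′_j(U₀)λ)(y)".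

WHAT THIS FILE ADDS TO `B8Thm8TorusWitness` + `B8Thm8FlatAbelianFamily` (0 sorry; OUR construction throughout).  Those
two files kernel the cell objection GAPS G-B8-13 for the flat abelian model in the EXPONENTIAL CHART (gauge
transformations = Lie-algebra functions λ, (1.29) read as Q′_Kλ = 0, U′^{u⁻¹} read as A′ + D^ηλ) and flag as HONEST
SCOPE (g) that a `U(1)`-valued restricted `u` outside the chart was excluded only by a prose argument.  Here that
argument is kernel-checked and the chart is removed:
 * §1 `pot_shift_sub` — the discrete Poincaré lemma WITH HOLONOMY on the torus `Site P i`: a real bond field with zero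
   circulation around every plaquette (`CurlFree`) and around every coordinate cycle (`HolFree`) is the gradient of
   the explicit potential `pot` (integrate along the coordinate path e_0, e_1, …; ladder Stokes + the cycle condition
   at the wrap-around).
 * §2 `exists_real_lift` — a `Real.Angle`-valued (= `U(1)`-valued) site function `θ` whose bond phases (principal
   values of `θ(x + e_μ) − θ(x)`) are `≤ δ` with `δ < π/2` and `N·δ < 2π` is `e^{iλ}` for a real `λ` whose increments ARE
   the bond phases (pure gauge ⇒ plaquette phase sums and cycle phase sums are multiples of 2π, hence 0 by size).
 * §3 `avgA`, `avgIter` — the averaging tower (78)–(80) of [3] at `U₀ = 1` for `U(1)`-valued functions (block centre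
   `emb` of `Setup`, principal logarithm `Real.Angle.toReal`), and its EXACT linearisation `avgIter_coe`:
   `avgIter j (e^{iλ}) = e^{i Q_j λ}` (`Q_j = B1RG242Torus.Qk`) as soon as at every level the block means of `λ`
   oscillate by `< π` between a point and the centre of its block (`avgA_coe` is p. 80's sentence, exact for the
   abelian group).
 * §4 `abs_Qk_osc_le` — for a `δ`-Lipschitz `λ` on the fine torus the `l`-fold means oscillate by `≤ 2δ·d·L^{l+1}` inside a
   block (coordinate path to the corner of the `(l+1)`-block; `B1RG242Torus.Qk_mulVec`, `card_Bj`).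
 * §5 `angleGF P : B8SectGH.GFData3` — the `U(1)`-VALUED flat abelian model (fields as in `flatGF` except `GT`, `Pert`
   angle-valued, `act` = genuine conjugation, potentials = principal logarithms `apot`, `Restricted` = genuine (81));
   `lift_restricted` — THE LIFTING LEMMA: a restricted `U(1)`-valued `u` whose pure gauge has `|A| < b`, `b·d·L^m ≤ 1`,
   is `e^{iλ}` with `Q′_Kλ = 0` and `A = D^ηλ` (§§1–4 + "all K-fold means are the SAME multiple of 2π", by the global
   oscillation bound `2δ d N ≤ 4 < 2π`, shifted away); `not_thm8PrintedAt_angle : ∀ B₁ B₂, ¬ Thm8PrintedAt 1 B₁ B₂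
   (fun K ↦ angleGF (withK P K))` (+ `_R`, `_Printed` forms): as in the chart file, with `α₀ + α₁ = t = min(c₁,
   1/(B₁dL^m))` so that the |A|-member of (1.36) delivered BY THE THEOREM makes the lifting lemma applicable, after which
   `B8Thm8FlatAbelianFamily.no_restricted_landau_solution` ends the proof (B₁ ≤ 0 is absurd at once).

HONEST SCOPE.  (a)–(f) and (h) of `B8Thm8FlatAbelianFamily` apply verbatim (one admitted instance; only the ∇- and
Hölder members of (1.36) under the printed hypothesis on f are refuted; what survives is typed in `B8.Thm8Inspected`
etc.; the consumer (125) of CMP 102 is unaffected; γ = 1; finite tori of record, family index K; flat scalar product,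
D^{η*} = transpose; norms = p. 86 suprema over Ω_j = T_η).  (g′) WHAT REPLACES (g): the group IS `U(1)` (phases in
`Real.Angle = ℝ/2πℤ`, principal logarithm `toReal ∈ (−π, π]`); the only conventions fixed by us are (i) the block
"centre" `v(y)` of (78) is `emb y` of `Setup` (B12's centred cubes; with B5/B7's corner convention the same proofs go
through with `fibreSite … 0`), (ii) the parallel transporters `R(V₀(Γ_{y,x}))` of (78) are `1` (`U₀ = 1`), (iii) (81) is
imposed on the whole unit lattice `T₁^{(K)}` (constant domain sequence, (1.5): Λ_k = Ω_k^{(k)}), (iv) `U′^{u⁻¹}(b) =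
u(b₋)⁻¹U′(b)u(b₊)` (p. 80 "we will use inverse elements u⁻¹"; the opposite convention flips the sign of A, immaterial).
(j) Non-abelian groups are not treated (the objection's mechanism is group-independent, the model is abelian by design).
(k) No claim about the Yang–Mills programme or the mass gap is made or implied.

CELL BOOK-KEEPING (lit-balaban r05 gen 17).  ROWS-B8 row B8.Thm8; B8-CLOSURE.md §5 item 1b (iii); GAPS G-B8-13 KERNEL
FOLLOW-UP.  VALUE = closes HONEST SCOPE (g) of the G-B8-13 kernel refutation; NOT summit progress.
-/

noncomputable section

open scoped BigOperators
open Finset Matrix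

namespace Literature.MathematicalPhysics.QuantumFieldTheory.Balaban1983to89.B8Thm8U1Family

variable {P : Params} {i : ℕ}

/-! ## §1 The discrete Poincaré lemma with holonomy on the torus `Site P i` -/

section Poincare

/-- `x` with its `μ`-th label replaced by `t`. [folklore] -/
def setC (x : Site P i) (μ : Fin P.d) (t : ℕ) : Site P i := Function.update x μ (t : ZMod (P.sitesPerDir i))

/-- The sum of `a_μ` along the `μ`-line through `x`, from label `0` up to (excluding) the label of `x`. [folklore] -/
def lineSum (a : Fin P.d → Site P i → ℝ) (μ : Fin P.d) (x : Site P i) : ℝ :=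
  ∑ t ∈ range (x μ).val, a μ (setC x μ t)

/-- `x` with the labels in the directions `≥ n` replaced by `0`. [folklore] -/
def trunc (n : ℕ) (x : Site P i) : Site P i := fun ν => if ν.val < n then x ν else 0

/-- The potential: integrate `a` from the origin along the coordinate path `e_0, e_1, …, e_{d−1}`. [folklore] -/
def pot (a : Fin P.d → Site P i → ℝ) (x : Site P i) : ℝ := ∑ μ : Fin P.d, lineSum a μ (trunc (μ.val + 1) x)

/-- Zero circulation around every plaquette. [cite: Balaban1985RegularSpaces, Thm 8 p.101 + (1.29) p.81 + (1.36) p.82] -/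
def CurlFree (a : Fin P.d → Site P i → ℝ) : Prop :=
  ∀ x μ ν, a μ x + a ν (Site.shift x μ) = a ν x + a μ (Site.shift x ν)

/-- Zero circulation around every coordinate cycle of the torus. [cite: Balaban1985RegularSpaces, Thm 8 p.101 + (1.29) p.81 + (1.36) p.82] -/
def HolFree (a : Fin P.d → Site P i → ℝ) : Prop :=
  ∀ x μ, ∑ t ∈ range (P.sitesPerDir i), a μ (setC x μ t) = 0

/-- Resetting a label to its own value does nothing. [folklore] -/
private theorem setC_val_self (x : Site P i) (μ : Fin P.d) : setC x μ (x μ).val = x := by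
  simp [setC]

/-- The reset label. [folklore] -/
private theorem setC_apply_self (x : Site P i) (μ : Fin P.d) (t : ℕ) :
    setC x μ t μ = (t : ZMod (P.sitesPerDir i)) := by
  simp [setC]

/-- The other labels are untouched. [folklore] -/
private theorem setC_apply_other (x : Site P i) {μ ν : Fin P.d} (h : ν ≠ μ) (t : ℕ) : setC x μ t ν = x ν := by
  simp [setC, Function.update_of_ne h]

/-- Two resets of the same label: the last wins. [folklore] -/
private theorem setC_setC (x : Site P i) (μ : Fin P.d) (t t' : ℕ) : setC (setC x μ t) μ t' = setC x μ t' := by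
  simp [setC]

/-- `(x with μ-label t) + e_μ = x with μ-label t + 1` (exact in `ZMod N`). [folklore] -/
private theorem shift_setC (x : Site P i) (μ : Fin P.d) (t : ℕ) : Site.shift (setC x μ t) μ = setC x μ (t + 1) := by
  unfold Site.shift setC
  rw [Function.update_idem, Function.update_self]
  push_cast
  rfl

/-- Resetting the `μ`-label forgets a `μ`-shift. [folklore] -/
private theorem setC_shift_self (x : Site P i) (μ : Fin P.d) (t : ℕ) : setC (Site.shift x μ) μ t = setC x μ t := by
  unfold Site.shift setC
  rw [Function.update_idem]

/-- Resetting the `μ`-label commutes with a `ν`-shift, `ν ≠ μ`. [folklore] -/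
private theorem setC_shift_other (x : Site P i) {μ ν : Fin P.d} (h : ν ≠ μ) (t : ℕ) :
    setC (Site.shift x ν) μ t = Site.shift (setC x μ t) ν := by
  unfold Site.shift setC
  rw [Function.update_comm h]
  congr 1
  rw [Function.update_of_ne h]

/-- A `μ`-shift does not move the other labels. [folklore] -/
private theorem shift_apply_other (x : Site P i) {μ ν : Fin P.d} (h : ν ≠ μ) : Site.shift x μ ν = x ν := by
  simp [Site.shift, Function.update_of_ne h]

/-- Label of `x + e_μ` in direction `μ`: `(n + 1) mod N`. [folklore] -/
private theorem val_shift_self (x : Site P i) (μ : Fin P.d) :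
    ((Site.shift x μ) μ).val = ((x μ).val + 1) % P.sitesPerDir i := by
  haveI : Fact (1 < P.sitesPerDir i) := ⟨P.one_lt_sitesPerDir i⟩
  simp only [Site.shift, Function.update_self]
  rw [ZMod.val_add, ZMod.val_one]

/-- Along its own direction the line sum gains the term at `x` (the wrap-around case uses the cycle condition). [folklore] -/
private theorem lineSum_shift_self {a : Fin P.d → Site P i → ℝ} (hH : HolFree a) (x : Site P i) (μ : Fin P.d) :
    lineSum a μ (Site.shift x μ) - lineSum a μ x = a μ x := by
  unfold lineSum
  simp_rw [setC_shift_self]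
  rw [val_shift_self]
  have hlt : (x μ).val < P.sitesPerDir i := ZMod.val_lt _
  by_cases hw : (x μ).val + 1 < P.sitesPerDir i
  · rw [Nat.mod_eq_of_lt hw, Finset.sum_range_succ, setC_val_self]
    ring
  · have hN : (x μ).val + 1 = P.sitesPerDir i := by omega
    rw [hN, Nat.mod_self, Finset.sum_range_zero]
    have h := hH x μ
    rw [← hN, Finset.sum_range_succ, setC_val_self] at h
    linarith

/-- Across another direction the line sum changes by a boundary term (ladder Stokes, from `CurlFree`). [folklore] -/
private theorem lineSum_shift_other {a : Fin P.d → Site P i → ℝ} (hC : CurlFree a) (x : Site P i) {μ ν : Fin P.d}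
    (h : ν ≠ μ) : lineSum a μ (Site.shift x ν) - lineSum a μ x = a ν x - a ν (setC x μ 0) := by
  unfold lineSum
  rw [shift_apply_other x h.symm]
  simp_rw [setC_shift_other x h]
  rw [← Finset.sum_sub_distrib]
  have hstep : ∀ t : ℕ, a μ (Site.shift (setC x μ t) ν) - a μ (setC x μ t)
      = a ν (setC x μ (t + 1)) - a ν (setC x μ t) := by
    intro t
    have := hC (setC x μ t) μ ν
    rw [shift_setC] at this
    linarith
  simp_rw [hstep]
  rw [Finset.sum_range_sub (fun t => a ν (setC x μ t)), setC_val_self]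

/-- Truncation below `ν` forgets a `ν`-shift. [folklore] -/
private theorem trunc_shift_of_le {n : ℕ} (x : Site P i) {ν : Fin P.d} (h : n ≤ ν.val) :
    trunc n (Site.shift x ν) = trunc n x := by
  funext ρ
  unfold trunc
  by_cases hρ : ρ.val < n
  · have hne : ρ ≠ ν := by intro e; subst e; omega
    simp [hρ, shift_apply_other x hne]
  · simp [hρ]

/-- Truncation above `ν` commutes with a `ν`-shift. [folklore] -/
private theorem trunc_shift_of_lt {n : ℕ} (x : Site P i) {ν : Fin P.d} (h : ν.val < n) :
    trunc n (Site.shift x ν) = Site.shift (trunc n x) ν := by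
  funext ρ
  unfold trunc Site.shift
  by_cases hρ : ρ = ν
  · subst hρ; simp [h]
  · simp [Function.update_of_ne hρ]

/-- Zeroing the `μ`-label of the `(μ+1)`-truncation gives the `μ`-truncation. [folklore] -/
private theorem setC_trunc_succ (x : Site P i) (μ : Fin P.d) : setC (trunc (μ.val + 1) x) μ 0 = trunc μ.val x := by
  funext ρ
  unfold setC trunc
  by_cases hρ : ρ = μ
  · subst hρ; simp
  · rw [Function.update_of_ne hρ]
    have : ρ.val ≠ μ.val := fun e => hρ (Fin.ext e)
    by_cases h1 : ρ.val < μ.val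
    · simp [h1, show ρ.val < μ.val + 1 by omega]
    · simp [h1, show ¬ ρ.val < μ.val + 1 by omega]

/-- Truncation at `d` is the identity. [folklore] -/
private theorem trunc_d (x : Site P i) : trunc P.d x = x := by
  funext ρ; simp [trunc, ρ.isLt]

/-- **Discrete Poincaré lemma with holonomy on the torus**: a real bond field with zero circulation around every plaquette
and around every coordinate cycle is the gradient of the potential `pot a`. [cite: Balaban1985RegularSpaces, (1.29) p.81 + p.80] -/
theorem pot_shift_sub {a : Fin P.d → Site P i → ℝ} (hC : CurlFree a) (hH : HolFree a) (x : Site P i) (ν : Fin P.d) :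
    pot a (Site.shift x ν) - pot a x = a ν x := by
  unfold pot
  rw [← Finset.sum_sub_distrib]
  -- the term-wise evaluation
  set h : ℕ → ℝ := fun m => a ν (trunc m x) with hh
  set F : ℕ → ℝ := fun m => if m < ν.val then 0 else if m = ν.val then h (ν.val + 1) else h (m + 1) - h m with hF
  have hterm : ∀ μ : Fin P.d,
      lineSum a μ (trunc (μ.val + 1) (Site.shift x ν)) - lineSum a μ (trunc (μ.val + 1) x) = F μ.val := by
    intro μ
    by_cases h1 : μ.val < ν.val
    · rw [trunc_shift_of_le x (by omega : μ.val + 1 ≤ ν.val)]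
      simp [hF, h1]
    · rw [trunc_shift_of_lt x (by omega : ν.val < μ.val + 1)]
      by_cases h2 : μ = ν
      · subst h2
        rw [lineSum_shift_self hH]
        simp [hF, hh]
      · have h2' : μ.val ≠ ν.val := fun e => h2 (Fin.ext e)
        rw [lineSum_shift_other hC _ (Ne.symm h2), setC_trunc_succ]
        simp [hF, hh, h1, h2']
  rw [Finset.sum_congr rfl fun μ _ => hterm μ, Fin.sum_univ_eq_sum_range F P.d]
  -- evaluate the range sum: zero below ν, one term at ν, telescoping above
  have hν : ν.val + 1 ≤ P.d := ν.isLt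
  rw [← Finset.sum_range_add_sum_Ico F hν, Finset.sum_range_succ]
  have hlow : ∑ m ∈ range ν.val, F m = 0 := Finset.sum_eq_zero fun m hm => by
    simp [hF, Finset.mem_range.mp hm]
  have hmid : F ν.val = h (ν.val + 1) := by simp [hF]
  have hhigh : ∑ m ∈ Ico (ν.val + 1) P.d, F m = h P.d - h (ν.val + 1) := by
    rw [Finset.sum_Ico_eq_sum_range]
    have : ∀ k ∈ range (P.d - (ν.val + 1)), F (ν.val + 1 + k) = h (ν.val + 1 + (k + 1)) - h (ν.val + 1 + k) := by
      intro k _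
      simp [hF, Nat.add_assoc]
    rw [Finset.sum_congr rfl this, Finset.sum_range_sub (fun k => h (ν.val + 1 + k))]
    have : ν.val + 1 + (P.d - (ν.val + 1)) = P.d := by omega
    rw [this, Nat.add_zero]
  rw [hlow, hmid, hhigh, hh]
  simp only [trunc_d]
  ring

end Poincare

/-! ## §2 Small-phase `U(1)`-valued site functions on the torus lift to real functions with small increments -/

section Lift

open Real

/-- The bond phase of a `U(1)`-valued (angle-valued) site function: the principal value of `θ(x + e_μ) − θ(x)` —
`η A_μ(x)` for the pure gauge `U₁(x, x + e_μ) = u(x)⁻¹u(x + e_μ)`, `u = e^{iθ}`, read through `A = (1/iη) log U₁`. [folklore] -/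
def bphase (θ : Site P i → Angle) (μ : Fin P.d) (x : Site P i) : ℝ := (θ (Site.shift x μ) - θ x).toReal

/-- The bond phase as an angle is the difference of the end-point phases. [folklore] -/
private theorem coe_bphase (θ : Site P i → Angle) (μ : Fin P.d) (x : Site P i) :
    (bphase θ μ x : Angle) = θ (Site.shift x μ) - θ x := by
  simp [bphase, Angle.coe_toReal]

/-- Unit shifts commute. [folklore] -/
private theorem shift_shift_comm (x : Site P i) (μ ν : Fin P.d) :
    Site.shift (Site.shift x μ) ν = Site.shift (Site.shift x ν) μ := by
  by_cases h : ν = μ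
  · rw [h]
  · unfold Site.shift
    rw [Function.update_of_ne h, Function.update_of_ne (Ne.symm h), Function.update_comm h]

/-- A real number whose angle is `0` and whose size is `< 2π` is `0`. [folklore] -/
private theorem eq_zero_of_coe_eq_zero {r : ℝ} (h0 : (r : Angle) = 0) (hr : |r| < 2 * π) : r = 0 := by
  obtain ⟨n, hn⟩ := Angle.coe_eq_zero_iff.mp h0
  rw [← hn, zsmul_eq_mul, abs_mul, abs_of_pos Real.two_pi_pos] at hr
  have h1 : |(n : ℝ)| < 1 := by
    by_contra hc
    rw [not_lt] at hc
    have := mul_le_mul_of_nonneg_right hc Real.two_pi_pos.le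
    linarith
  have h2 : n = 0 := by
    have : |(n : ℝ)| = ((|n| : ℤ) : ℝ) := (Int.cast_abs).symm
    rw [this] at h1
    have h3 : |n| < 1 := by exact_mod_cast h1
    have := abs_nonneg n
    interval_cases h : |n|
    exact abs_eq_zero.mp h
  rw [← hn, h2]
  simp

/-- Plaquette phases of a pure gauge vanish: small bond phases are curl-free. [cite: Balaban1985RegularSpaces, (1.29) p.81 + p.80] -/
theorem curlFree_bphase (θ : Site P i → Angle) (hδ : ∀ μ x, |bphase θ μ x| < π / 2) : CurlFree (bphase θ) := by
  intro x μ ν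
  have h0 : ((bphase θ μ x + bphase θ ν (Site.shift x μ) - (bphase θ ν x + bphase θ μ (Site.shift x ν)) : ℝ) : Angle)
      = 0 := by
    simp only [Angle.coe_add, Angle.coe_sub, coe_bphase, shift_shift_comm x ν μ]
    abel
  have hb : |bphase θ μ x + bphase θ ν (Site.shift x μ) - (bphase θ ν x + bphase θ μ (Site.shift x ν))| < 2 * π := by
    have h1 := hδ μ x; have h2 := hδ ν (Site.shift x μ); have h3 := hδ ν x; have h4 := hδ μ (Site.shift x ν)
    have h5 : |bphase θ μ x + bphase θ ν (Site.shift x μ) - (bphase θ ν x + bphase θ μ (Site.shift x ν))|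
        ≤ (|bphase θ μ x| + |bphase θ ν (Site.shift x μ)|) + (|bphase θ ν x| + |bphase θ μ (Site.shift x ν)|) :=
      le_trans (abs_sub _ _) (add_le_add (abs_add_le _ _) (abs_add_le _ _))
    linarith [Real.pi_pos]
  have := eq_zero_of_coe_eq_zero h0 hb
  linarith

/-- Cycle holonomies of a pure gauge vanish: bond phases with `N·δ < 2π` have zero cycle sums. [cite: Balaban1985RegularSpaces, (1.29) p.81 + p.80] -/
theorem holFree_bphase (θ : Site P i → Angle) {δ : ℝ} (hδ : ∀ μ x, |bphase θ μ x| ≤ δ)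
    (hN : (P.sitesPerDir i : ℝ) * δ < 2 * π) : HolFree (bphase θ) := by
  intro x μ
  have h0 : ((∑ t ∈ range (P.sitesPerDir i), bphase θ μ (setC x μ t) : ℝ) : Angle) = 0 := by
    have hs : ((∑ t ∈ range (P.sitesPerDir i), bphase θ μ (setC x μ t) : ℝ) : Angle)
        = ∑ t ∈ range (P.sitesPerDir i), ((bphase θ μ (setC x μ t) : ℝ) : Angle) :=
      map_sum Angle.coeHom _ _
    rw [hs]
    simp only [coe_bphase, shift_setC]
    rw [Finset.sum_range_sub (fun t => θ (setC x μ t))]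
    have : setC x μ (P.sitesPerDir i) = setC x μ 0 := by
      unfold setC; simp
    rw [this, sub_self]
  have hb : |∑ t ∈ range (P.sitesPerDir i), bphase θ μ (setC x μ t)| < 2 * π := by
    refine lt_of_le_of_lt (Finset.abs_sum_le_sum_abs _ _) ?_
    refine lt_of_le_of_lt (Finset.sum_le_sum fun t _ => hδ μ (setC x μ t)) ?_
    simpa using hN
  exact eq_zero_of_coe_eq_zero h0 hb

/-- **Small-phase lifting on the torus**: an angle-valued site function all of whose bond phases are `≤ δ` with
`δ < π/2` and `N·δ < 2π` (`N` = sites per direction) is `e^{iλ}` for a REAL site function `λ` whose increments ARE the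
bond phases. [cite: Balaban1985RegularSpaces, (1.29) p.81 + p.80] -/
theorem exists_real_lift (θ : Site P i → Angle) {δ : ℝ} (hδ : ∀ μ x, |bphase θ μ x| ≤ δ) (hδπ : δ < π / 2)
    (hN : (P.sitesPerDir i : ℝ) * δ < 2 * π) :
    ∃ lam : Site P i → ℝ, (∀ x, (lam x : Angle) = θ x) ∧ ∀ μ x, lam (Site.shift x μ) - lam x = bphase θ μ x := by
  have hC : CurlFree (bphase θ) := curlFree_bphase θ fun μ x => lt_of_le_of_lt (hδ μ x) hδπ
  have hH : HolFree (bphase θ) := holFree_bphase θ hδ hN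
  -- ψ = θ − ↑pot is shift-invariant, hence constant
  set ψ : Site P i → Angle := fun x => θ x - (pot (bphase θ) x : ℝ) with hψ
  have hψinv : ∀ μ x, ψ (Site.shift x μ) = ψ x := by
    intro μ x
    have h1 := pot_shift_sub hC hH x μ
    have h2 : ((pot (bphase θ) (Site.shift x μ) : ℝ) : Angle) = (pot (bphase θ) x : ℝ) + (bphase θ μ x : ℝ) := by
      rw [← Angle.coe_add]; congr 1; linarith
    simp only [hψ, h2, coe_bphase]
    abel
  have hconst : ∀ x, ψ x = ψ default := by
    intro x
    have hr := Site.const_of_shift_invariant (fun x => (ψ x).toReal) (fun μ x => by simp only [hψinv]) x default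
    exact Angle.toReal_injective hr
  refine ⟨fun x => pot (bphase θ) x + (ψ default).toReal, fun x => ?_, fun μ x => ?_⟩
  · rw [Angle.coe_add, Angle.coe_toReal, ← hconst x]
    exact add_sub_cancel _ _
  · have := pot_shift_sub hC hH x μ
    show pot (bphase θ) (Site.shift x μ) + (ψ default).toReal - (pot (bphase θ) x + (ψ default).toReal) = _
    linarith

end Lift

/-! ## §3 The block-averaging tower (78)–(81) of [3] for `U(1)`-valued gauge transformations at `U₀ = 1` -/

section Tower

open Real
open B1RG242Torus (Q Qk avgMat avgMat_mulVec Qk_succ lvl lvl_of_le)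

variable (P)

/-- ONE-STEP AVERAGING (78) of [3] at `V₀ = 1` for an angle-valued (`U(1)`-valued) function `φ` on `T^{(j)}`:
`(R₀v)(y) = v(y)·exp[i Σ_{x ∈ B(y)} L^{−d} (1/i) log(v(y)⁻¹ v(x))]` — with `v = e^{iφ}`, `v(y)` = the value at the centre
`emb y` of the block, and `(1/i) log` the principal logarithm (`Real.Angle.toReal`). [cite: Balaban1985Averaging, (78)–(81) p.30] -/
def avgA (j : ℕ) (φ : Site P j → Angle) : Site P (j + 1) → Angle :=
  fun y => φ (emb y) + ((((P.L : ℝ) ^ P.d)⁻¹ * ∑ x ∈ block y, (φ x - φ (emb y)).toReal : ℝ) : Angle)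

/-- THE ITERATED AVERAGES (79)–(80) of [3] at `U₀ = 1`: `ū⁰ = u`, `ū^{j+1} = R₀ ū^j`. [cite: Balaban1985Averaging, (78)–(81) p.30] -/
def avgIter : (j : ℕ) → (Site P 0 → Angle) → (Site P j → Angle)
  | 0, φ => φ
  | j + 1, φ => avgA P j (avgIter j φ)

variable {P}

/-- `(Q φ)(y) = L^{−d} Σ_{x ∈ B(y)} φ(x)` for the tree's one-step plain average (`B1RG242Torus.Q_mulVec`). [folklore] -/
private theorem Q_mulVec_eq {j : ℕ} (hj : j + 1 ≤ P.m + P.K) (φ : Site P j → ℝ) (y : Site P (j + 1)) :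
    (Q P j *ᵥ φ) y = ((P.L : ℝ) ^ P.d)⁻¹ * ∑ x ∈ block y, φ x :=
  B1RG242Torus.Q_mulVec 0 0 hj φ y

/-- LINEARISATION OF ONE STEP (p. 80: "for u(x) = e^{iλ(x)} and λ small a linear part of the function (1/i) log(R₀u^j)(y)
is equal to (Q′_j(U₀)λ)(y)" — EXACT for the abelian group): if `φ = e^{iλ}` with all `|λ(x) − λ(centre of x's block)|
< π`, then `R₀(e^{iλ}) = e^{iQλ}`. [cite: Balaban1985RegularSpaces, p.80] [cite: Balaban1985Averaging, (78)–(81) p.30] -/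
theorem avgA_coe {j : ℕ} (hj : j + 1 ≤ P.m + P.K) (lam : Site P j → ℝ)
    (hosc : ∀ x, |lam x - lam (emb (blockOf x))| < π) (y : Site P (j + 1)) :
    avgA P j (fun x => (lam x : Angle)) y = ((Q P j *ᵥ lam) y : Angle) := by
  unfold avgA
  have hsum : ∑ x ∈ block y, (((lam x : Angle) - (lam (emb y) : Angle))).toReal
      = ∑ x ∈ block y, (lam x - lam (emb y)) := by
    refine Finset.sum_congr rfl fun x hx => ?_
    have hxy : blockOf x = y := (Finset.mem_filter.mp hx).2
    rw [← Angle.coe_sub, Angle.toReal_coe_eq_self_iff]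
    have h := hosc x
    rw [hxy] at h
    constructor <;> linarith [abs_lt.mp h]
  rw [hsum, Finset.sum_sub_distrib, Finset.sum_const, Site.card_block hj, nsmul_eq_mul, Q_mulVec_eq hj,
    ← Angle.coe_add]
  congr 1
  have hL : ((P.L : ℝ) ^ P.d) ≠ 0 := pow_ne_zero _ P.cast_L_pos.ne'
  field_simp
  push_cast
  ring

/-- `Q_0`-fold = identity: `Qk P 0 = 1` as an operator. [folklore] -/
private theorem Qk_zero_mulVec (lam : Site P 0 → ℝ) : Qk P 0 *ᵥ lam = lam := by
  funext y
  show (avgMat P 0 0 (lvl P 0) _ *ᵥ lam) y = lam y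
  rw [avgMat_mulVec, lvl_of_le P (Nat.zero_le _), pow_zero]
  simp_rw [Site.proj_zero, one_mul]
  rw [Finset.sum_ite_eq', if_pos (Finset.mem_univ _)]

/-- LINEARISATION OF THE TOWER: if at every level `l < j` the `l`-fold means `Q_l λ` oscillate by `< π` between a point and
the centre of its block, then `avgIter j (e^{iλ}) = e^{i Q_j λ}` (`Q_j` = `B1RG242Torus.Qk`, the `j`-fold block mean).
[cite: Balaban1985RegularSpaces, p.80 + (1.29) p.81] [cite: Balaban1985Averaging, (78)–(81) p.30] -/
theorem avgIter_coe {j : ℕ} (hj : j ≤ P.m + P.K) (lam : Site P 0 → ℝ)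
    (hosc : ∀ l, l < j → ∀ x : Site P l, |(Qk P l *ᵥ lam) x - (Qk P l *ᵥ lam) (emb (blockOf x))| < π) :
    avgIter P j (fun x => (lam x : Angle)) = fun y => ((Qk P j *ᵥ lam) y : Angle) := by
  induction j with
  | zero => funext y; simp [avgIter, Qk_zero_mulVec]
  | succ j ih =>
    have ih' := ih (by omega) (fun l hl => hosc l (by omega))
    funext y
    show avgA P j (avgIter P j fun x => (lam x : Angle)) y = _
    rw [ih', avgA_coe (by omega) _ (hosc j (by omega)) y, Qk_succ, ← Matrix.mulVec_mulVec]

end Tower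

/-! ## §4 Oscillation of the block means of a Lipschitz function -/

section Osc

open B1RG242Torus (Qk avgMat avgMat_mulVec lvl lvl_of_le sitesPerDir_zero_eq sitesPerDir_eq_succ stepExp
  stepExp_of_lt proj_comp_lvl)

/-- Moving `n − m` steps along one coordinate line changes a `δ`-Lipschitz function by at most `δ·(n − m)`. [folklore] -/
private theorem abs_sub_setC_le (lam : Site P 0 → ℝ) {δ : ℝ} (hδ : ∀ μ x, |lam (Site.shift x μ) - lam x| ≤ δ)
    (z : Site P 0) (κ : Fin P.d) {m n : ℕ} (hmn : m ≤ n) :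
    |lam (setC z κ n) - lam (setC z κ m)| ≤ δ * ((n - m : ℕ) : ℝ) := by
  induction n, hmn using Nat.le_induction with
  | base => simp
  | succ n hmn ih =>
    have h1 := hδ κ (setC z κ n)
    rw [shift_setC] at h1
    calc |lam (setC z κ (n + 1)) - lam (setC z κ m)|
        ≤ |lam (setC z κ (n + 1)) - lam (setC z κ n)| + |lam (setC z κ n) - lam (setC z κ m)| := abs_sub_le _ _ _
      _ ≤ δ + δ * ((n - m : ℕ) : ℝ) := add_le_add h1 ih
      _ = δ * ((n + 1 - m : ℕ) : ℝ) := by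
        rw [show n + 1 - m = (n - m) + 1 by omega]
        push_cast
        ring

/-- The coordinate path from `c` to `p`: the first `k` labels from `p`, the others from `c`. [folklore] -/
def mix (k : ℕ) (p c : Site P 0) : Site P 0 := fun ν => if ν.val < k then p ν else c ν

/-- The path starts at `c`. [folklore] -/
private theorem mix_zero (p c : Site P 0) : mix 0 p c = c := by
  funext ν; simp [mix]

/-- The path ends at `p`. [folklore] -/
private theorem mix_d (p c : Site P 0) : mix P.d p c = p := by
  funext ν; simp [mix, ν.isLt]

/-- One more coordinate from `p`. [folklore] -/
private theorem mix_succ (p c : Site P 0) (κ : Fin P.d) :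
    mix (κ.val + 1) p c = setC (mix κ.val p c) κ (p κ).val := by
  funext ν
  unfold mix setC
  by_cases h : ν = κ
  · subst h; simp
  · rw [Function.update_of_ne h]
    have : ν.val ≠ κ.val := fun e => h (Fin.ext e)
    by_cases h1 : ν.val < κ.val
    · simp [h1, show ν.val < κ.val + 1 by omega]
    · simp [h1, show ¬ ν.val < κ.val + 1 by omega]

/-- The `κ`-th label of `mix κ p c` is `c`'s. [folklore] -/
private theorem mix_self (p c : Site P 0) (κ : Fin P.d) :
    mix κ.val p c = setC (mix κ.val p c) κ (c κ).val := by
  funext ν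
  unfold mix setC
  by_cases h : ν = κ
  · subst h; simp
  · rw [Function.update_of_ne h]

/-- Along the coordinate path: `|λ(p) − λ(c)| ≤ δ·d·M` when every label of `p` exceeds that of `c` by at most `M`.
[folklore] -/
private theorem abs_sub_corner_le (lam : Site P 0 → ℝ) {δ : ℝ} (hδ : ∀ μ x, |lam (Site.shift x μ) - lam x| ≤ δ)
    (hδ0 : 0 ≤ δ) (p c : Site P 0) {M : ℕ} (hle : ∀ κ, (c κ).val ≤ (p κ).val)
    (hM : ∀ κ, (p κ).val - (c κ).val ≤ M) : |lam p - lam c| ≤ δ * (P.d * M : ℕ) := by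
  have key : ∀ k, k ≤ P.d → |lam (mix k p c) - lam c| ≤ δ * (k * M : ℕ) := by
    intro k hk
    induction k with
    | zero => simp [mix_zero]
    | succ k ih =>
      have hk' : k < P.d := by omega
      set κ : Fin P.d := ⟨k, hk'⟩ with hκ
      have h1 : |lam (mix (k + 1) p c) - lam (mix k p c)| ≤ δ * M := by
        have e1 : mix (k + 1) p c = setC (mix k p c) κ (p κ).val := mix_succ p c κ
        have e2 : mix k p c = setC (mix k p c) κ (c κ).val := mix_self p c κ
        rw [e1]
        conv_lhs => rw [e2]
        rw [setC_setC]
        refine le_trans (abs_sub_setC_le lam hδ _ κ (hle κ)) ?_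
        exact mul_le_mul_of_nonneg_left (by exact_mod_cast hM κ) hδ0
      calc |lam (mix (k + 1) p c) - lam c|
          ≤ |lam (mix (k + 1) p c) - lam (mix k p c)| + |lam (mix k p c) - lam c| := abs_sub_le _ _ _
        _ ≤ δ * M + δ * (k * M : ℕ) := add_le_add h1 (ih (by omega))
        _ = δ * ((k + 1) * M : ℕ) := by push_cast; ring
  have := key P.d le_rfl
  rwa [mix_d] at this

variable {l : ℕ}

/-- `N₀ = L^l · N_l`. [folklore] -/
private theorem h0l (l : ℕ) (hl : l ≤ P.m + P.K) : P.sitesPerDir 0 = P.L ^ l * P.sitesPerDir l := by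
  have h := sitesPerDir_zero_eq P l
  rwa [lvl_of_le P hl] at h

/-- The corner (lowest labels) of the `(l+1)`-block of the unit… of the fine block `B^{l+1}(blockOf x)` over `x ∈ T^{(l)}`.
[folklore] -/
def corner (x : Site P l) : Site P 0 := Site.fibreSite 0 (l + 1) (blockOf x) (fun _ => ⟨0, pow_pos P.L_pos _⟩)

/-- The centre of a block has the same corner. [folklore] -/
private theorem corner_emb_blockOf (hl : l + 1 ≤ P.m + P.K) (x : Site P l) : corner (emb (blockOf x)) = corner x := by
  unfold corner
  rw [Site.blockOf_emb hl]

/-- A fine site of `B^l(x)` lies in the fine block `B^{l+1}(blockOf x)`: its labels exceed the corner's by `< L^{l+1}`.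
[folklore] -/
private theorem labels_of_mem (hl : l + 1 ≤ P.m + P.K) (x : Site P l) (p : Site P 0) (hp : Site.proj l l p = x) (κ : Fin P.d) :
    (corner x κ).val ≤ (p κ).val ∧ (p κ).val - (corner x κ).val < P.L ^ (l + 1) := by
  have h01 : P.sitesPerDir 0 = P.L ^ (l + 1) * P.sitesPerDir (l + 1) := h0l (l + 1) hl
  have hval : (corner x κ).val = (blockOf x κ).val * P.L ^ (l + 1) := by
    unfold corner
    rw [Site.val_fibreSite h01]
    simp
  have hproj : Site.proj (l + 1) (l + 1) p = blockOf x := by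
    have h := proj_comp_lvl P l p
    rw [stepExp_of_lt P hl, lvl_of_le P (by omega : l ≤ P.m + P.K), hp, Site.proj_one_eq_blockOf] at h
    exact h.symm
  have hdiv : (p κ).val / P.L ^ (l + 1) = (blockOf x κ).val := by
    rw [← Site.val_proj h01 p κ, hproj]
  rw [hval, ← hdiv]
  have hpos : 0 < P.L ^ (l + 1) := pow_pos P.L_pos _
  constructor
  · exact Nat.div_mul_le_self _ _
  · have := Nat.lt_div_mul_add (a := (p κ).val) hpos
    omega

/-- The `l`-fold block mean at `x` differs from `λ(c)` by at most `δ·d·M` when every fine site of `B^l(x)` has labels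
above those of `c` by at most `M`. [folklore] -/
private theorem abs_Qk_sub_ref_le (hl' : l ≤ P.m + P.K) (lam : Site P 0 → ℝ) {δ : ℝ}
    (hδ : ∀ μ x, |lam (Site.shift x μ) - lam x| ≤ δ) (hδ0 : 0 ≤ δ) (x : Site P l) (c : Site P 0) {M : ℕ}
    (href : ∀ p : Site P 0, Site.proj l l p = x → ∀ κ, (c κ).val ≤ (p κ).val ∧ (p κ).val - (c κ).val ≤ M) :
    |(Qk P l *ᵥ lam) x - lam c| ≤ δ * (P.d * M : ℕ) := by
  set S := Finset.univ.filter (fun p : Site P 0 => Site.proj l l p = x) with hS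
  have hcard : S.card = (P.L ^ l) ^ P.d := B1RG242Torus.card_Bj hl' x
  set w : ℝ := (((P.L : ℝ) ^ P.d)⁻¹) ^ l with hw
  have hwpos : 0 ≤ w := by positivity
  have hw1 : w * S.card = 1 := by
    rw [hcard, hw]
    push_cast
    rw [← pow_mul, inv_pow, ← pow_mul, mul_comm P.d l, inv_mul_cancel₀]
    exact pow_ne_zero _ P.cast_L_pos.ne'
  have hQ : (Qk P l *ᵥ lam) x = w * ∑ p ∈ S, lam p := B1RG242Torus.Qk_mulVec 0 0 hl' lam x
  have hrepr : (Qk P l *ᵥ lam) x - lam c = w * ∑ p ∈ S, (lam p - lam c) := by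
    rw [hQ, Finset.sum_sub_distrib, Finset.sum_const, nsmul_eq_mul, mul_sub, ← mul_assoc, hw1, one_mul]
  rw [hrepr, abs_mul, abs_of_nonneg hwpos]
  have hterm : ∀ p ∈ S, |lam p - lam c| ≤ δ * (P.d * M : ℕ) := by
    intro p hp
    have hpx : Site.proj l l p = x := (Finset.mem_filter.mp hp).2
    exact abs_sub_corner_le lam hδ hδ0 p c (fun κ => (href p hpx κ).1) (fun κ => (href p hpx κ).2)
  calc w * |∑ p ∈ S, (lam p - lam c)|
      ≤ w * ∑ p ∈ S, |lam p - lam c| := mul_le_mul_of_nonneg_left (Finset.abs_sum_le_sum_abs _ _) hwpos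
    _ ≤ w * ∑ p ∈ S, δ * (P.d * M : ℕ) := mul_le_mul_of_nonneg_left (Finset.sum_le_sum hterm) hwpos
    _ = δ * (P.d * M : ℕ) := by rw [Finset.sum_const, nsmul_eq_mul, ← mul_assoc, hw1, one_mul]

/-- The block mean of a constant is the constant (`L^{−ld}·|B^l(y)| = 1`). [cite: Balaban1982Higgs1, (2.11) p.609] -/
theorem Qk_mulVec_const (hl' : l ≤ P.m + P.K) (r : ℝ) (x : Site P l) : (Qk P l *ᵥ fun _ => r) x = r := by
  have hQ : (Qk P l *ᵥ fun _ => r) x = (((P.L : ℝ) ^ P.d)⁻¹) ^ l * ∑ p ∈ Finset.univ.filter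
      (fun p : Site P 0 => Site.proj l l p = x), r := B1RG242Torus.Qk_mulVec 0 0 hl' (fun _ => r) x
  rw [hQ, Finset.sum_const, B1RG242Torus.card_Bj hl' x, nsmul_eq_mul, ← mul_assoc]
  push_cast
  rw [← pow_mul, inv_pow, ← pow_mul, mul_comm P.d l, inv_mul_cancel₀ (pow_ne_zero _ P.cast_L_pos.ne'), one_mul]

/-- The `l`-fold block mean at `x` differs from `λ` at the corner of `B^{l+1}(blockOf x)` by at most `δ·d·L^{l+1}`.
[folklore] -/
private theorem abs_Qk_sub_corner_le (hl : l + 1 ≤ P.m + P.K) (lam : Site P 0 → ℝ) {δ : ℝ}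
    (hδ : ∀ μ x, |lam (Site.shift x μ) - lam x| ≤ δ) (hδ0 : 0 ≤ δ) (x : Site P l) :
    |(Qk P l *ᵥ lam) x - lam (corner x)| ≤ δ * (P.d * P.L ^ (l + 1) : ℕ) :=
  abs_Qk_sub_ref_le (by omega) lam hδ hδ0 x (corner x)
    (fun p hp κ => ⟨(labels_of_mem hl x p hp κ).1, (labels_of_mem hl x p hp κ).2.le⟩)

/-- Globally on the torus: the `l`-fold block mean differs from `λ` at the origin by at most `δ·d·N`. [folklore] -/
private theorem abs_Qk_sub_origin_le (hl' : l ≤ P.m + P.K) (lam : Site P 0 → ℝ) {δ : ℝ}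
    (hδ : ∀ μ x, |lam (Site.shift x μ) - lam x| ≤ δ) (hδ0 : 0 ≤ δ) (x : Site P l) :
    |(Qk P l *ᵥ lam) x - lam (fun _ => 0)| ≤ δ * (P.d * P.sitesPerDir 0 : ℕ) :=
  abs_Qk_sub_ref_le hl' lam hδ hδ0 x (fun _ => 0)
    (fun p _ κ => ⟨by simp, by simpa using (ZMod.val_lt (p κ)).le⟩)

/-- **OSCILLATION OF THE BLOCK MEANS**: for a `δ`-Lipschitz `λ` on the fine torus, the `l`-fold mean at `x ∈ T^{(l)}` and at
the centre of `x`'s block differ by at most `2δ·d·L^{l+1}`. [cite: Balaban1987RG1, (0.1)–(0.3) pp.251–252] -/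
theorem abs_Qk_osc_le (hl : l + 1 ≤ P.m + P.K) (lam : Site P 0 → ℝ) {δ : ℝ}
    (hδ : ∀ μ x, |lam (Site.shift x μ) - lam x| ≤ δ) (hδ0 : 0 ≤ δ) (x : Site P l) :
    |(Qk P l *ᵥ lam) x - (Qk P l *ᵥ lam) (emb (blockOf x))| ≤ 2 * (δ * (P.d * P.L ^ (l + 1) : ℕ)) := by
  have h1 := abs_Qk_sub_corner_le hl lam hδ hδ0 x
  have h2 := abs_Qk_sub_corner_le hl lam hδ hδ0 (emb (blockOf x))
  rw [corner_emb_blockOf hl] at h2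
  calc |(Qk P l *ᵥ lam) x - (Qk P l *ᵥ lam) (emb (blockOf x))|
      ≤ |(Qk P l *ᵥ lam) x - lam (corner x)| + |lam (corner x) - (Qk P l *ᵥ lam) (emb (blockOf x))| :=
        abs_sub_le _ _ _
    _ ≤ _ := by rw [abs_sub_comm (lam (corner x))]; linarith

end Osc

/-! ## §5 The `U(1)`-valued flat abelian family and Theorem 8 AS PRINTED on it -/

section Family

open Real
open B1RG242Torus (Qk H deriv deriv_mulVec)
open B8Thm8TorusWitness (dir0 lam0 ctr withK Qk_lam0 abs_H_zero_lam0_le)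
open B8Thm8FlatAbelianFamily (BondField grad div InN InRange ProjEq norm2 gradNorm3 norm2_le
  no_restricted_landau_solution)

variable (P)

/-- The vector potential `A = (1/iη) log U₁` of an angle-valued bond configuration `Θ = ηA` (principal logarithm,
`Real.Angle.toReal`; `η = ε`). [folklore] -/
def apot (Θ : Fin P.d → Site P 0 → Angle) : BondField P := fun μ x => P.eps⁻¹ * (Θ μ x).toReal

/-- **The `U(1)`-VALUED flat abelian model of Theorem 8 on the torus of record `P`, packaged as `B8SectGH.GFData3`** —
the model of `B8Thm8FlatAbelianFamily.flatGF` with the exponential chart REMOVED: gauge transformations `GT` are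
`U(1)`-valued site functions (`Real.Angle`-valued phases `θ`, `u = e^{iθ}`), perturbations `Pert` are `U(1)`-valued bond
functions (`Θ = ηA′` as angles, `U′ = e^{iΘ}`), `act Θ′ θ = Θ′ + (θ(b₊) − θ(b₋))` is the genuine `U′^{u⁻¹}` for the abelian
group, the potential of a configuration is its PRINCIPAL logarithm `apot` (`A = (1/iη) log U₁`, p. 81), `Restricted θ` is
the genuine condition (1.29)/(81) of [3] "(R₀ū^k)(y) = 1" with the exp-mean-arg averages (78)–(80) at `U₀ = 1`
(`avgIter`, centre convention `emb` of `Setup`); all other fields exactly as in `flatGF` (hypothesis fields pin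
`U₀ = 1`, `U′ = 1`; `C136` = the |A|- and ∇-members of (1.36) at the top level; `LandauF` = (1.146) as the orthogonal-
projection equation; `C137 = C139 = True`).
[cite: Balaban1985RegularSpaces, (1.29) p.81 + (1.33)–(1.39) pp.82–83 + (1.146) p.101] [cite: Balaban1985Averaging, (78)–(81) p.30] -/
def angleGF : B8SectGH.GFData3 where
  Cfg := Unit
  Pert := Fin P.d → Site P 0 → Angle
  GT := Site P 0 → Angle
  Src := Site P 0 → ℝ
  k := P.K
  InA := fun α₀ _ => 0 < α₀
  Reg335 := fun α₀ _ => 0 < α₀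
  InAAx := fun α₀ _ Θ' => Θ' = 0 ∧ 0 < α₀
  avgClose := fun α₁ _ Θ' => Θ' = 0 ∧ 0 < α₁
  avgClose166 := fun α₁ _ Θ' => Θ' = 0 ∧ 0 < α₁
  Restricted := fun _ θ => ∀ y, avgIter P P.K θ y = 0
  act := fun Θ' θ => fun μ x => Θ' μ x + (θ (Site.shift x μ) - θ x)
  C136 := fun B₁ _ s _ Θ =>
    (∀ μ x, |apot P Θ μ x| < B₁ * s) ∧ ∀ μ ν x, |(deriv P 0 P.eps μ *ᵥ apot P Θ ν) x| < B₁ * s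
  C137 := fun _ _ _ => True
  Landau := fun _ Θ => ProjEq P (div P (apot P Θ)) 0
  C139 := fun _ _ _ _ => True
  C162 := fun B s _ Θ => ∀ μ x, |apot P Θ μ x| < B * s
  fNorm := fun f => norm2 P f
  LandauF := fun _ f Θ => ProjEq P (div P (apot P Θ)) f
  InAPair := fun _ _ _ => True
  fGrad := fun _ f => gradNorm3 P f
  C140 := fun _ _ _ => True
  InR := fun _ f => InRange P f

variable {P}

/-- **THE LIFTING LEMMA** (HONEST SCOPE (g) of `B8Thm8FlatAbelianFamily`, now kernel-checked): a `U(1)`-valued gauge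
transformation `θ` on the torus of record which is (1.29)-restricted and whose pure gauge `U′^{u⁻¹}` (`U′ = 1`) has a
potential with `|A| < b`, `b ≤ 1/(d·L^m)`, is `e^{iλ}` for a REAL `λ` with `Q′_K λ = 0` and `A = D^η λ` — i.e. lies in the
exponential chart. [cite: Balaban1985RegularSpaces, (1.29) p.81 + (1.36) p.82] -/
theorem lift_restricted (θ : Site P 0 → Angle) {b : ℝ} (hb0 : 0 ≤ b)
    (hb : b * (P.d * P.L ^ P.m : ℕ) ≤ 1)
    (hA : ∀ μ x, |apot P (fun μ x => (0 : Fin P.d → Site P 0 → Angle) μ x + (θ (Site.shift x μ) - θ x)) μ x| < b)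
    (hR : ∀ y, avgIter P P.K θ y = 0) :
    ∃ lam : Site P 0 → ℝ, (∀ x, (lam x : Angle) = θ x) ∧ InN P lam ∧
      apot P (fun μ x => (0 : Fin P.d → Site P 0 → Angle) μ x + (θ (Site.shift x μ) - θ x)) = grad P lam := by
  -- sizes
  have hd1 : (1 : ℝ) ≤ P.d := by exact_mod_cast P.hd
  have hL1 : (1 : ℝ) ≤ P.L := by exact_mod_cast P.L_pos
  have hLm1 : (1 : ℝ) ≤ (P.L : ℝ) ^ P.m := one_le_pow₀ hL1
  have hdLm : (1 : ℝ) ≤ (P.d * P.L ^ P.m : ℕ) := by push_cast; nlinarith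
  have hb1 : b ≤ 1 := by nlinarith
  have hbd : b * P.d ≤ 1 := by
    have : b * P.d ≤ b * (P.d * P.L ^ P.m : ℕ) := by
      push_cast; exact mul_le_mul_of_nonneg_left (by nlinarith) hb0
    linarith
  have hε : 0 < P.eps := P.eps_pos
  have hε1 : P.eps ≤ 1 := by
    unfold Params.eps
    exact pow_le_one₀ (inv_nonneg.mpr P.cast_L_pos.le) (inv_le_one_of_one_le₀ hL1)
  have hεK : P.eps * (P.L : ℝ) ^ P.K = 1 := by
    unfold Params.eps; rw [inv_pow, inv_mul_cancel₀ (pow_ne_zero _ P.cast_L_pos.ne')]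
  have hN : (P.sitesPerDir 0 : ℝ) = 2 * ((P.L : ℝ) ^ P.m * (P.L : ℝ) ^ P.K) := by
    unfold Params.sitesPerDir; push_cast; rw [Nat.sub_zero, pow_add]
  -- the bond phases are ε·A
  set δ : ℝ := P.eps * b with hδdef
  have hδ0 : 0 ≤ δ := mul_nonneg hε.le hb0
  have hphase : ∀ μ x, bphase θ μ x = P.eps *
      apot P (fun μ x => (0 : Fin P.d → Site P 0 → Angle) μ x + (θ (Site.shift x μ) - θ x)) μ x := by
    intro μ x
    simp only [apot, bphase, Pi.zero_apply, zero_add]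
    rw [← mul_assoc, mul_inv_cancel₀ hε.ne', one_mul]
  have hδb : ∀ μ x, |bphase θ μ x| ≤ δ := by
    intro μ x
    rw [hphase, abs_mul, abs_of_pos hε]
    exact mul_le_mul_of_nonneg_left (hA μ x).le hε.le
  have hδπ : δ < π / 2 := by
    have : δ ≤ 1 := by rw [hδdef]; nlinarith
    linarith [Real.pi_gt_three]
  have hNδ : (P.sitesPerDir 0 : ℝ) * δ < 2 * π := by
    rw [hN, hδdef]
    have : 2 * ((P.L : ℝ) ^ P.m * (P.L : ℝ) ^ P.K) * (P.eps * b) = 2 * (b * (P.L : ℝ) ^ P.m) := by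
      calc 2 * ((P.L : ℝ) ^ P.m * (P.L : ℝ) ^ P.K) * (P.eps * b)
          = 2 * (b * (P.L : ℝ) ^ P.m) * (P.eps * (P.L : ℝ) ^ P.K) := by ring
        _ = 2 * (b * (P.L : ℝ) ^ P.m) := by rw [hεK, mul_one]
    rw [this]
    have : b * (P.L : ℝ) ^ P.m ≤ 1 := by
      have : b * (P.L : ℝ) ^ P.m ≤ b * (P.d * P.L ^ P.m : ℕ) := by
        push_cast; exact mul_le_mul_of_nonneg_left (by nlinarith) hb0
      linarith
    linarith [Real.pi_gt_three]
  -- the real lift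
  obtain ⟨lam, hlam, hinc⟩ := exists_real_lift θ hδb hδπ hNδ
  have hLip : ∀ μ x, |lam (Site.shift x μ) - lam x| ≤ δ := fun μ x => by rw [hinc]; exact hδb μ x
  have hθ : θ = fun x => (lam x : Angle) := funext fun x => (hlam x).symm
  -- the averages are the block means
  have hKle : P.K ≤ P.m + P.K := Nat.le_add_left _ _
  have hosc : ∀ l, l < P.K → ∀ x : Site P l, |(Qk P l *ᵥ lam) x - (Qk P l *ᵥ lam) (emb (blockOf x))| < π := by
    intro l hl x
    refine lt_of_le_of_lt (abs_Qk_osc_le (by omega) lam hLip hδ0 x) ?_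
    have h1 : ((P.d * P.L ^ (l + 1) : ℕ) : ℝ) ≤ P.d * (P.L : ℝ) ^ P.K := by
      push_cast
      exact mul_le_mul_of_nonneg_left (pow_le_pow_right₀ hL1 (by omega)) (by positivity)
    have h2 : δ * (P.d * (P.L : ℝ) ^ P.K) = b * P.d := by
      rw [hδdef]
      calc P.eps * b * (P.d * (P.L : ℝ) ^ P.K) = b * P.d * (P.eps * (P.L : ℝ) ^ P.K) := by ring
        _ = b * P.d := by rw [hεK, mul_one]
    have h3 : δ * ((P.d * P.L ^ (l + 1) : ℕ) : ℝ) ≤ b * P.d := by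
      rw [← h2]; exact mul_le_mul_of_nonneg_left h1 hδ0
    linarith [Real.pi_gt_three]
  have havg := avgIter_coe hKle lam hosc
  -- (1.29): every block mean is a multiple of 2π, the same one
  have hmean : ∀ y, ∃ n : ℤ, (n : ℝ) * (2 * π) = (Qk P P.K *ᵥ lam) y := by
    intro y
    have h := hR y
    rw [hθ, havg] at h
    obtain ⟨n, hn⟩ := Angle.coe_eq_zero_iff.mp h
    exact ⟨n, by rw [← hn, zsmul_eq_mul]⟩
  have hglob : ∀ y, |(Qk P P.K *ᵥ lam) y - lam (fun _ => 0)| ≤ 2 := by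
    intro y
    refine le_trans (abs_Qk_sub_origin_le hKle lam hLip hδ0 y) ?_
    rw [hδdef]
    have : P.eps * b * ((P.d * P.sitesPerDir 0 : ℕ) : ℝ) = 2 * (b * (P.d * P.L ^ P.m : ℕ)) := by
      push_cast
      rw [hN]
      calc P.eps * b * (P.d * (2 * ((P.L : ℝ) ^ P.m * (P.L : ℝ) ^ P.K)))
          = 2 * (b * (P.d * (P.L : ℝ) ^ P.m)) * (P.eps * (P.L : ℝ) ^ P.K) := by ring
        _ = 2 * (b * (P.d * (P.L : ℝ) ^ P.m)) := by rw [hεK, mul_one]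
    rw [this]
    linarith
  choose n hn using hmean
  have hconst : ∀ y, n y = n default := by
    intro y
    have h1 := hglob y
    have h2 := hglob default
    rw [← hn y] at h1
    rw [← hn default] at h2
    have h3 : |((n y : ℝ) - n default) * (2 * π)| ≤ 4 := by
      have := abs_sub_le ((n y : ℝ) * (2 * π)) (lam fun _ => 0) ((n default : ℝ) * (2 * π))
      rw [abs_sub_comm (lam fun _ => 0)] at this
      rw [sub_mul]
      linarith
    rw [abs_mul, abs_of_pos Real.two_pi_pos] at h3
    have h4 : |((n y : ℝ) - n default)| < 1 := by
      by_contra hc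
      rw [not_lt] at hc
      have := mul_le_mul_of_nonneg_right hc Real.two_pi_pos.le
      linarith [Real.pi_gt_three]
    have h5 : |n y - n default| < 1 := by
      have : (|((n y : ℝ) - n default)|) = ((|n y - n default| : ℤ) : ℝ) := by push_cast; rfl
      rw [this] at h4
      exact_mod_cast h4
    have h6 := abs_nonneg (n y - n default)
    have h7 : |n y - n default| = 0 := by omega
    exact sub_eq_zero.mp (abs_eq_zero.mp h7)
  -- shift the lift by the common multiple of 2π
  set c : ℝ := (n default : ℝ) * (2 * π) with hcdef
  refine ⟨fun x => lam x - c, fun x => ?_, ?_, ?_⟩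
  · rw [Angle.coe_sub, hlam x, hcdef, ← zsmul_eq_mul, Angle.coe_zsmul, Angle.coe_two_pi, zsmul_zero, sub_zero]
  · -- Q′_K (λ − c) = n·2π − c = 0
    unfold InN
    funext y
    have hsplit : (fun x => lam x - c) = lam - fun _ => c := rfl
    rw [hsplit, Matrix.mulVec_sub, Pi.sub_apply, Qk_mulVec_const hKle, ← hn y, hconst y, hcdef, Pi.zero_apply, sub_self]
  · funext μ x
    simp only [grad, deriv_mulVec]
    rw [show lam (Site.shift x μ) - c - (lam x - c) = lam (Site.shift x μ) - lam x by ring, hinc μ x, hphase μ x,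
      ← mul_assoc, inv_mul_cancel₀ hε.ne', one_mul]

/-- **THEOREM 8 AS PRINTED FAILS FOR THE `U(1)`-VALUED FLAT ABELIAN FAMILY** (every `B₁, B₂`; index `K`, `ε = L^{−K}`,
`d ≥ 2`, `L`, `m` fixed): the chart-free version of `B8Thm8FlatAbelianFamily.not_thm8PrintedAt`.  Given the theorem's
`c₁`, take `K` with `(K − 1)·log L − 5/2 > 4B₁`, `α₀ = α₁ = t/2` with `t = min(c₁, 1/(B₁dL^m))` (so that the |A|-member
makes the lifting lemma applicable), `U₀ = U′ = 1`, `f = Δ^ε_1(s·λ₀)`, `s = t/4`; the restricted `U(1)`-valued `u`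
delivered by the theorem lifts to a real `λ` with `Q′_Kλ = 0`, `A = D^ηλ` (`lift_restricted`), and then
`B8Thm8FlatAbelianFamily.no_restricted_landau_solution` refutes the top-level ∇-member of (1.36).
[cite: Balaban1985RegularSpaces, Thm 8 p.101 + (1.36) p.82] -/
theorem not_thm8PrintedAt_angle (hd : 2 ≤ P.d) (B₁ B₂ : ℝ) :
    ¬ B8SectGH.Thm8PrintedAt 1 B₁ B₂ (fun K : ℕ => angleGF (withK P K)) := by
  rintro ⟨c₁, hc₁, hT⟩
  have hL1 : (1 : ℝ) < P.L := by have := P.hL.2; exact_mod_cast this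
  have hlog : 0 < Real.log P.L := Real.log_pos hL1
  obtain ⟨n, hn⟩ := exists_nat_gt ((4 * B₁ + 5 / 2) / Real.log P.L)
  set K : ℕ := n + 2 with hKdef
  have hK2 : 2 ≤ (withK P K).K := by show 2 ≤ n + 2; omega
  have hrate : 4 * B₁ < (((withK P K).K - 1 : ℕ) : ℝ) * Real.log (withK P K).L - 5 / 2 := by
    have h3 : (((withK P K).K - 1 : ℕ) : ℝ) = n + 1 := by
      show (((n + 2 - 1 : ℕ) : ℝ)) = n + 1
      push_cast [show n + 2 - 1 = n + 1 by omega]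
      ring
    have h6 : (withK P K).L = P.L := rfl
    rw [h3, h6]
    have h4 : (4 * B₁ + 5 / 2) / Real.log P.L * Real.log P.L = 4 * B₁ + 5 / 2 := div_mul_cancel₀ _ hlog.ne'
    have h5 : (n : ℝ) * Real.log P.L > 4 * B₁ + 5 / 2 := by
      rw [← h4]; exact mul_lt_mul_of_pos_right hn hlog
    nlinarith
  -- the smallness parameter t = α₀ + α₁
  set D : ℝ := ((P.d * P.L ^ P.m : ℕ) : ℝ) with hDdef
  have hD1 : 1 ≤ D := by
    rw [hDdef]; push_cast
    have hd1 : (1 : ℝ) ≤ P.d := by exact_mod_cast P.hd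
    nlinarith [one_le_pow₀ (M₀ := ℝ) hL1.le (n := P.m)]
  set t : ℝ := if B₁ ≤ 0 then c₁ else min c₁ (1 / (B₁ * D)) with htdef
  have ht0 : 0 < t := by
    rw [htdef]; split_ifs with h
    · exact hc₁
    · exact lt_min hc₁ (by rw [not_le] at h; positivity)
  have htc : t ≤ c₁ := by
    rw [htdef]; split_ifs
    · exact le_rfl
    · exact min_le_left _ _
  have htB : B₁ * t * D ≤ 1 := by
    rw [htdef]; split_ifs with h
    · have : B₁ * c₁ * D ≤ 0 := by
        have := mul_nonpos_of_nonpos_of_nonneg (mul_nonpos_of_nonpos_of_nonneg h hc₁.le) (by linarith : (0:ℝ) ≤ D)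
        linarith
      linarith
    · rw [not_le] at h
      have hBD : 0 < B₁ * D := by positivity
      calc B₁ * min c₁ (1 / (B₁ * D)) * D ≤ B₁ * (1 / (B₁ * D)) * D := by
            have := min_le_right c₁ (1 / (B₁ * D))
            nlinarith
        _ = 1 := by field_simp
  have hc2 : 0 < t / 2 := by positivity
  set s : ℝ := t / 4 with hsdef
  have hs : 0 < s := by positivity
  set f : Site (withK P K) 0 → ℝ := H (withK P K) 0 *ᵥ (s • lam0 (withK P K) hd) with hfdef
  have hN0 : InN (withK P K) (s • lam0 (withK P K) hd) := by
    unfold InN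
    rw [Matrix.mulVec_smul, Qk_lam0 (P := withK P K) hd (by show 1 ≤ n + 2; omega), smul_zero]
  have hInR : InRange (withK P K) f := ⟨s • lam0 (withK P K) hd, hN0, rfl⟩
  have hnorm : norm2 (withK P K) f < 1 * (t / 2 + t / 2) := by
    have hle : norm2 (withK P K) f ≤ 2 * s := by
      apply norm2_le (by positivity)
      intro x
      rw [hfdef, Matrix.mulVec_smul, Pi.smul_apply, smul_eq_mul, abs_mul, abs_of_pos hs]
      have := abs_H_zero_lam0_le (withK P K) hd (by show 1 ≤ n + 2; omega) x
      nlinarith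
    rw [hsdef] at hle
    linarith
  have hT' := hT K (t / 2) (t / 2) hc2 hc2 (by linarith)
  dsimp only [angleGF] at hT'
  obtain ⟨θ, hR, ⟨⟨h136a, h136b⟩, -, -, hLF⟩, -⟩ := hT' () 0 f hc2 hc2 ⟨rfl, hc2⟩ ⟨rfl, hc2⟩ hInR hnorm
  -- the case B₁ ≤ 0 is absurd at once
  by_cases hB : B₁ ≤ 0
  · have h1 := h136a (dir0 (withK P K) hd) (ctr (withK P K) hd)
    have h2 : B₁ * (t / 2 + t / 2) ≤ 0 := mul_nonpos_of_nonpos_of_nonneg hB (by linarith)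
    linarith [abs_nonneg (apot (withK P K) (fun μ x => (0 : Fin (withK P K).d → Site (withK P K) 0 → Angle) μ x +
      (θ (Site.shift x μ) - θ x)) (dir0 (withK P K) hd) (ctr (withK P K) hd))]
  rw [not_le] at hB
  -- lift the restricted U(1)-valued u to the chart
  have hb : B₁ * (t / 2 + t / 2) * ((((withK P K).d * (withK P K).L ^ (withK P K).m : ℕ)) : ℝ) ≤ 1 := by
    have : (((withK P K).d * (withK P K).L ^ (withK P K).m : ℕ) : ℝ) = D := rfl
    rw [this, show t / 2 + t / 2 = t by ring]
    exact htB
  obtain ⟨lam, -, hRl, hgrad⟩ := lift_restricted (P := withK P K) θ (by positivity) hb h136a hR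
  rw [hgrad] at hLF h136b
  have hB' : B₁ * (t / 2 + t / 2) ≤ s * ((((withK P K).K - 1 : ℕ) : ℝ) * Real.log (withK P K).L - 5 / 2) := by
    rw [hsdef]
    nlinarith
  refine no_restricted_landau_solution (P := withK P K) hd hK2 hs hB' lam hRl ?_ ?_
  · rw [zero_add]; exact hLF
  · intro μ ν x; rw [zero_add]; exact h136b μ ν x

/-- The literal ∀γ reading fails too for the `U(1)`-valued family. [cite: Balaban1985RegularSpaces, Thm 8 p.101] -/
theorem not_thm8PrintedR_angle (hd : 2 ≤ P.d) (B₁ B₂ : ℝ) :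
    ¬ B8SectGH.Thm8PrintedR B₁ B₂ (fun K : ℕ => angleGF (withK P K)) :=
  fun h => not_thm8PrintedAt_angle hd B₁ B₂ (B8SectGH.thm8PrintedAt_one_of_R B₁ B₂ _ h)

/-- r1's typing `B8.Thm8Printed` fails for the `U(1)`-valued family. [cite: Balaban1985RegularSpaces, Thm 8 p.101] -/
theorem not_thm8Printed_angle (hd : 2 ≤ P.d) (B₁ B₂ : ℝ) :
    ¬ B8.Thm8Printed B₁ B₂ (fun K : ℕ => (angleGF (withK P K)).toGFData) :=
  fun h => not_thm8PrintedAt_angle hd B₁ B₂ (B8SectGH.thm8PrintedAt_one_of_printed B₁ B₂ _ h)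

end Family

end Literature.MathematicalPhysics.QuantumFieldTheory.Balaban1983to89.B8Thm8U1Family
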